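import Summits.ABC.ABC.Theorems.PrimePowerRadical.Negative.Orders
import Summits.ABC.ABC.Theorems.PrimePowerRadical.Negative.DoubleWall
import Summits.ABC.ABC.Theorems.PrimePowerRadical.Negative.LinearLoss

/-!
# `PrimePowerRadical` at a prime `q` ⟺ the level averages `(1/k)·Σ_{d ∣ k} E_q(d)` tend to `0`

Stub `stub_PPRAt_iff_levelAverage` of the line `Sketch` (card `adelic-brjuno-summability`, crux
stmt-ABC-1648 `Summit.ABC.ABC.Theses.IneffectiveSubspace.PrimePowerRadical`), ported from
`Cruxes/PrimePowerRadical/SketchIdeator2g2.lean` (`log_oddWieferichExcess_eq`, `fiber_eq`,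
`log_oddWieferichExcess_eq_sum_levelExcess`, `wieferichSparse_iff_tendsto`, `PPRAt_iff_levelAverage`).

Notation: `W_p := wieferichLevel q p`, `E_W(q,k) := oddWieferichExcess q k = ∏_{p odd, p ∣ q^k − 1} p^{W_p − 1}`,
`ord_p(q) := ordMod q p`, and the LEVEL EXCESS (kept inlined in every statement, no definition)
  `E_q(d) := Σ_{p odd, p ∣ q^d − 1, ord_p(q) = d} (W_p − 1) log p`
— the Wieferich mass charged to the cyclotomic level `d`.

What is proved (informally): for a prime `q`,
  `(∀ ε > 0, ∃ C > 0, ∀ k ≥ 1, q^k < C · rad(1·(q^k − 1)·q^k)^{1+ε})  ⟺  (1/k)·Σ_{d ∣ k} E_q(d) → 0`.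

Proof idea:
* `log E_W(q,k) = Σ_{p odd, p ∣ q^k−1} (W_p − 1) log p` (`Real.log_prod`);
* the odd primes of `q^k − 1` are fibred by `p ↦ ord_p(q)` over `k.divisors`
  (`p ∣ q^k − 1 ↔ ord_p(q) ∣ k`), and the fibre over `d ∣ k` is exactly the index set of `E_q(d)`,
  whence the EXACT IDENTITY `log E_W(q,k) = Σ_{d ∣ k} E_q(d)` for `k ≥ 1`;
* Wieferich sparsity `∀ ε > 0, ∃ C > 0, ∀ k ≥ 1, E_W(q,k) < C·q^{ε k}` is equivalent to
  `log E_W(q,k) / k → 0` (take logarithms; the finitely many small `k` are absorbed into `C`);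
* the crux at `q` is equivalent to Wieferich sparsity (`Negative.PPRAt_iff_wieferichSparse`).

Deliberately NOT here: the Brjuno-sum lever `WDC ⟹ WieferichSparse`, the atoms `c_p → 0`, Romanoff-type
estimates — those are other stubs of the line.
-/

noncomputable section

-- `Summit.<Summit>.<Problem>` is the mandated summit-side namespace (CONVENTIONS §2); for the
-- single-conjunct summit `ABC` the two coincide, so the duplicate `ABC.ABC` is deliberate.
set_option linter.dupNamespace false

namespace Summit.ABC.ABC.Theorems.PrimePowerRadical.Brjuno

open Literature.NumberTheory.DiophantineGeometry UniqueFactorizationMonoid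
open Summit.ABC.ABC.Theses.IneffectiveSubspace
open Summit.ABC.ABC.Theorems.PrimePowerRadical.Negative
open scoped BigOperators

/-- `log E_W(q,k)` as a sum over the odd primes of `q^k − 1`:
`log E_W(q,k) = Σ_{p odd, p ∣ q^k − 1} (W_p − 1) log p`. -/
theorem lav_log_oddWieferichExcess_eq (q k : ℕ) :
    Real.log (oddWieferichExcess q k) =
      ∑ p ∈ (q ^ k - 1).primeFactors.erase 2, ((wieferichLevel q p - 1 : ℕ) : ℝ) * Real.log p := by
  unfold oddWieferichExcess
  rw [Nat.cast_prod, Real.log_prod]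
  · apply Finset.sum_congr rfl
    intro p _
    rw [Nat.cast_pow, Real.log_pow]
  · intro p hp
    have hpr : p.Prime := Nat.prime_of_mem_primeFactors (Finset.mem_of_mem_erase hp)
    exact_mod_cast (pow_pos hpr.pos _).ne'

/-- The fibre of `ordMod q · = d` inside the odd primes of `q^k − 1` is the index set of the level
excess `E_q(d)` whenever `d ∣ k`, `k ≥ 1`, `d ≥ 1`. -/
theorem lav_fiber_eq {q k d : ℕ} (hq : 2 ≤ q) (hk : 1 ≤ k) (hd : d ∣ k) (hd1 : 1 ≤ d) :
    ((q ^ k - 1).primeFactors.erase 2).filter (fun p => ordMod q p = d) =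
      ((q ^ d - 1).primeFactors.erase 2).filter (fun p => ordMod q p = d) := by
  have hnk : q ^ k - 1 ≠ 0 := by have := two_le_pow hq hk; omega
  have hnd : q ^ d - 1 ≠ 0 := by have := two_le_pow hq hd1; omega
  ext p
  simp only [Finset.mem_filter, Finset.mem_erase, Nat.mem_primeFactors]
  constructor
  · rintro ⟨⟨hp2, hpr, hpk, -⟩, hpo⟩
    refine ⟨⟨hp2, hpr, ?_, hnd⟩, hpo⟩
    rw [dvd_pow_sub_one_iff_ordMod_dvd hpr (by omega), hpo]
  · rintro ⟨⟨hp2, hpr, hpd, -⟩, hpo⟩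
    refine ⟨⟨hp2, hpr, ?_, hnk⟩, hpo⟩
    rw [dvd_pow_sub_one_iff_ordMod_dvd hpr (by omega), hpo]
    exact hd

/-- EXACT `k`-SIDE IDENTITY: `log E_W(q,k) = Σ_{d ∣ k} E_q(d)` for a prime `q` and `k ≥ 1`
(the level excess `E_q(d)` is the inner sum). -/
theorem lav_log_oddWieferichExcess_eq_sum_levelExcess {q k : ℕ} (hq : q.Prime) (hk : 1 ≤ k) :
    Real.log (oddWieferichExcess q k) = ∑ d ∈ k.divisors,
      ∑ p ∈ ((q ^ d - 1).primeFactors.erase 2).filter (fun p => ordMod q p = d),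
        ((wieferichLevel q p - 1 : ℕ) : ℝ) * Real.log p := by
  have hq2 := hq.two_le
  rw [lav_log_oddWieferichExcess_eq]
  set S := (q ^ k - 1).primeFactors.erase 2 with hS
  have hmaps : ∀ p ∈ S, ordMod q p ∈ k.divisors := by
    intro p hp
    have hpP := Finset.mem_of_mem_erase hp
    have hpr : p.Prime := Nat.prime_of_mem_primeFactors hpP
    have hpk : p ∣ q ^ k - 1 := Nat.dvd_of_mem_primeFactors hpP
    exact Nat.mem_divisors.mpr ⟨(dvd_pow_sub_one_iff_ordMod_dvd hpr (by omega) k).mp hpk, by omega⟩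
  rw [← Finset.sum_fiberwise_of_maps_to hmaps]
  apply Finset.sum_congr rfl
  intro d hdk
  have hd : d ∣ k := Nat.dvd_of_mem_divisors hdk
  have hd1 : 1 ≤ d := Nat.pos_of_mem_divisors hdk
  rw [← lav_fiber_eq hq2 hk hd hd1]

/-- Wieferich sparsity at a prime `q` ⟺ `(log E_W(q,k))/k → 0`:
`(∀ ε > 0, ∃ C > 0, ∀ k ≥ 1, E_W(q,k) < C·q^{ε k}) ↔ log E_W(q,k) / k → 0`. -/
theorem lav_wieferichSparse_iff_tendsto {q : ℕ} (hq : q.Prime) :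
    (∀ ε : ℝ, 0 < ε → ∃ C : ℝ, 0 < C ∧ ∀ k : ℕ, 1 ≤ k →
      (oddWieferichExcess q k : ℝ) < C * (q : ℝ) ^ (ε * k)) ↔
      Filter.Tendsto (fun k : ℕ => Real.log (oddWieferichExcess q k) / (k : ℝ))
        Filter.atTop (nhds 0) := by
  have hq0 : (0 : ℝ) < q := by exact_mod_cast hq.pos
  have hq1 : (1 : ℝ) < q := by exact_mod_cast hq.one_lt
  have hlogq : 0 < Real.log q := Real.log_pos hq1
  have hE0 : ∀ k, (0 : ℝ) < oddWieferichExcess q k := fun k => by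
    exact_mod_cast oddWieferichExcess_pos q k
  have hE1 : ∀ k, (1 : ℝ) ≤ oddWieferichExcess q k := fun k => by
    exact_mod_cast oddWieferichExcess_pos q k
  have hlog0 : ∀ k, 0 ≤ Real.log (oddWieferichExcess q k) := fun k => Real.log_nonneg (hE1 k)
  constructor
  · intro h
    rw [Metric.tendsto_atTop]
    intro ε hε
    obtain ⟨C, hC, hCk⟩ := h (ε / (2 * Real.log q)) (by positivity)
    -- `N` with `log C / N < ε / 2`
    obtain ⟨N, hN⟩ := exists_nat_gt (2 * |Real.log C| / ε)
    refine ⟨N + 1, fun k hk => ?_⟩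
    have hk1 : 1 ≤ k := by omega
    have hkR : (0 : ℝ) < k := by exact_mod_cast (show 0 < k by omega)
    have h1 := hCk k hk1
    have h2 : Real.log (oddWieferichExcess q k) <
        Real.log C + ε / (2 * Real.log q) * k * Real.log q := by
      have := Real.log_lt_log (hE0 k) h1
      rw [Real.log_mul hC.ne' (Real.rpow_pos_of_pos hq0 _).ne', Real.log_rpow hq0] at this
      linarith
    have h3 : ε / (2 * Real.log q) * k * Real.log q = (ε / 2) * k := by
      field_simp
    rw [h3] at h2
    rw [Real.dist_eq, sub_zero, abs_of_nonneg (div_nonneg (hlog0 k) hkR.le), div_lt_iff₀ hkR]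
    have hNk : 2 * |Real.log C| / ε < k := lt_of_lt_of_le hN (by exact_mod_cast (by omega : N ≤ k))
    rw [div_lt_iff₀ hε] at hNk
    have hC' : Real.log C ≤ |Real.log C| := le_abs_self _
    nlinarith
  · intro h δ hδ
    rw [Metric.tendsto_atTop] at h
    obtain ⟨N, hN⟩ := h (δ * Real.log q) (by positivity)
    set B : ℝ := (∑ j ∈ Finset.range (N + 1), (oddWieferichExcess q j : ℝ)) + 2 with hB
    have hBsum0 : 0 ≤ ∑ j ∈ Finset.range (N + 1), (oddWieferichExcess q j : ℝ) :=
      Finset.sum_nonneg fun j _ => Nat.cast_nonneg _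
    have hB1 : 1 < B := by rw [hB]; linarith
    have hB0 : 0 < B := by linarith
    refine ⟨B, hB0, fun k hk => ?_⟩
    have hQ1 : (1 : ℝ) ≤ (q : ℝ) ^ (δ * k) := Real.one_le_rpow hq1.le (by positivity)
    have hQ0 : (0 : ℝ) < (q : ℝ) ^ (δ * k) := by positivity
    by_cases hkN : N ≤ k
    · have hkR : (0 : ℝ) < k := by exact_mod_cast (show 0 < k by omega)
      have h1 := hN k hkN
      rw [Real.dist_eq, sub_zero, abs_of_nonneg (div_nonneg (hlog0 k) hkR.le),
        div_lt_iff₀ hkR] at h1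
      -- `log E_W < δ log q · k ⟹ E_W < q^(δ k)`
      have hE : (oddWieferichExcess q k : ℝ) < (q : ℝ) ^ (δ * k) := by
        have e1 : (oddWieferichExcess q k : ℝ) = Real.exp (Real.log (oddWieferichExcess q k)) :=
          (Real.exp_log (hE0 k)).symm
        have e2 : (q : ℝ) ^ (δ * k) = Real.exp (Real.log q * (δ * k)) := Real.rpow_def_of_pos hq0 _
        rw [e1, e2]
        apply Real.exp_lt_exp.mpr
        have : Real.log q * (δ * k) = δ * Real.log q * k := by ring
        rw [this]
        exact h1
      calc (oddWieferichExcess q k : ℝ) < (q : ℝ) ^ (δ * k) := hE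
        _ = 1 * (q : ℝ) ^ (δ * k) := (one_mul _).symm
        _ ≤ B * (q : ℝ) ^ (δ * k) := mul_le_mul_of_nonneg_right hB1.le hQ0.le
    · have hkmem : k ∈ Finset.range (N + 1) := Finset.mem_range.mpr (by omega)
      have hle : (oddWieferichExcess q k : ℝ) ≤
          ∑ j ∈ Finset.range (N + 1), (oddWieferichExcess q j : ℝ) :=
        Finset.single_le_sum (fun j _ => Nat.cast_nonneg _) hkmem
      calc (oddWieferichExcess q k : ℝ)
            ≤ ∑ j ∈ Finset.range (N + 1), (oddWieferichExcess q j : ℝ) := hle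
        _ < B := by rw [hB]; linarith
        _ ≤ B * (q : ℝ) ^ (δ * k) := le_mul_of_one_le_right hB0.le hQ1

/-- **stub_PPRAt_iff_levelAverage (exact `k`-side reformulation).** The crux at a prime `q` holds iff
`(1/k)·Σ_{d ∣ k} E_q(d) → 0`, where `E_q(d) = Σ_{p odd, p ∣ q^d − 1, ord_p(q) = d} (W_p − 1) log p` is the
Wieferich mass charged to the cyclotomic level `d` (so `log E_W(q,k) = Σ_{d ∣ k} E_q(d)`). -/
theorem stub_PPRAt_iff_levelAverage {q : ℕ} (hq : q.Prime) :
    (∀ ε : ℝ, 0 < ε → ∃ C : ℝ, 0 < C ∧ ∀ k : ℕ, 1 ≤ k →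
      ((q ^ k : ℕ) : ℝ) < C * ((rad 1 (q ^ k - 1) (q ^ k) : ℕ) : ℝ) ^ (1 + ε)) ↔
      Filter.Tendsto (fun k : ℕ => (∑ d ∈ k.divisors,
        ∑ p ∈ ((q ^ d - 1).primeFactors.erase 2).filter (fun p => ordMod q p = d),
          ((wieferichLevel q p - 1 : ℕ) : ℝ) * Real.log p) / (k : ℝ)) Filter.atTop (nhds 0) := by
  have hfun : (fun k : ℕ => (∑ d ∈ k.divisors,
        ∑ p ∈ ((q ^ d - 1).primeFactors.erase 2).filter (fun p => ordMod q p = d),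
          ((wieferichLevel q p - 1 : ℕ) : ℝ) * Real.log p) / (k : ℝ)) =
      (fun k : ℕ => Real.log (oddWieferichExcess q k) / (k : ℝ)) := by
    funext k
    rcases Nat.eq_zero_or_pos k with rfl | hk
    · simp
    · rw [lav_log_oddWieferichExcess_eq_sum_levelExcess hq hk]
  rw [hfun, PPRAt_iff_wieferichSparse hq]
  exact lav_wieferichSparse_iff_tendsto hq

end Summit.ABC.ABC.Theorems.PrimePowerRadical.Brjuno

end
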